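import Literature.NumberTheory.LFunctions.HardyZExtremaCriterionProofs
import Literature.Analysis.Convex.FeasibleDirectionConditions
import Literature.Analysis.FluidPDE.TsaiMaximumPrinciple
import HarnessLib

/-!
# Crux `SigmaL` (stmt-RiemannHypothesis-24253), line `SigmaL_birth` — stub `stub_secondDerivTest`

The SECOND-DERIVATIVE TEST (necessary conditions) at the local extrema of Hardy's `Z`
(`Literature.NumberTheory.LFunctions.hardyZ`): at a local minimum `Z'(t) = 0` and `Z''(t) ≥ 0`,
at a local maximum `Z'(t) = 0` and `Z''(t) ≤ 0`, with Lean's total `deriv`.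

Only continuity of `Z` at the point is used: Fermat's theorem `IsLocalMin.deriv_eq_zero` is
unconditional for the total derivative, and the sign of `deriv (deriv Z)` is the in-tree
second-order necessary condition
`Literature.Analysis.Convex.FeasibleDirectionConditions.secondDeriv_nonneg_of_isLocalMin` /
`Literature.Analysis.FluidPDE.deriv_deriv_nonpos_of_isLocalMax` (contrapositives of Mathlib's
second-derivative test: a point that is both a local minimum and a local maximum is a point of
local constancy, where `deriv (deriv Z) = 0`). Continuity of `Z` comes from the in-tree derivative
`Literature.NumberTheory.LFunctions.Ivic2003.hasDerivAt_hardyZ`.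

This closes the registered stub `stub_secondDerivTest` of the skeleton `Cruxes/SigmaL` (birth line)
BY NAME; it says nothing about the other stub (`stub_laguerreAtCritical`, RH-strength) and nothing
here bears on the truth of RH.
-/

set_option linter.dupNamespace false

noncomputable section

open Filter Topology
open Literature.NumberTheory.LFunctions

namespace Summit.RiemannHypothesis.RiemannHypothesis.Theorems.SigmaLBirth

/-- **Stub `stub_secondDerivTest` of crux `SigmaL` (registered signature, skeleton `SigmaL_birth`):**
at every local minimum of Hardy's `Z` one has `Z' = 0` and `Z'' ≥ 0`, at every local maximum
`Z' = 0` and `Z'' ≤ 0` (total `deriv`; `Z` is differentiable by `Ivic2003.hasDerivAt_hardyZ`, and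
only its continuity is needed). Unconditional; nothing here bears on RH. -/
theorem stub_secondDerivTest : ∀ t : ℝ,
    (IsLocalMin hardyZ t → deriv hardyZ t = 0 ∧ 0 ≤ deriv (deriv hardyZ) t) ∧
    (IsLocalMax hardyZ t → deriv hardyZ t = 0 ∧ deriv (deriv hardyZ) t ≤ 0) := by
  intro t
  have hc : ContinuousAt hardyZ t := (Ivic2003.hasDerivAt_hardyZ t).continuousAt
  exact ⟨fun hmin ↦ ⟨hmin.deriv_eq_zero,
      Literature.Analysis.Convex.FeasibleDirectionConditions.secondDeriv_nonneg_of_isLocalMin hmin hc⟩,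
    fun hmax ↦ ⟨hmax.deriv_eq_zero,
      Literature.Analysis.FluidPDE.deriv_deriv_nonpos_of_isLocalMax hmax hc⟩⟩

end Summit.RiemannHypothesis.RiemannHypothesis.Theorems.SigmaLBirth

end
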